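import Mathlib
import HarnessLib
import Summits.NavierStokesRegularity.NavierStokesRegularity.Theorems.TaylorModelRungThreeCertificateCoreStepDefs

/-!
# Crux K1b-DR (stmt-NavierStokesRegularity-23954), line `taylor-model` — v3 read-outs, K-SIDE part 2: the IN-STEP objects of
# the last sub-step — kernel enclosure `inStepM` over `u ∈ [0,h]`, centre Taylor polynomial `coreTP` over a `u`-box, and the
# in-step state box `inStepY` of (R6) (typer g32; semantic clauses `InStepKer` / (R6) / (R10) of ns-tm-g4 g3's `…VReadoutsDefs`
# p625517; composed by engine-1 g67's interpretation)

No new kernel code: the (M) matrix `stepMatrixMF` (p622263) and its soundness `stepMatrixMF_spec` are ALREADY stated for an arbitrary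
real `u` with `u ∈ Hh`, so the in-step kernel enclosure over the whole last sub-step is the same matrix with `Hh := [0,h]` and the
remainder scale `S_r ∋ JU_r·u^(pV+1)` taken over `u ∈ [0,h]`; likewise the centre Taylor polynomial is `polyLevelsA` over the jets
of the point box of `x` at a `u`-box.

* `IntervalD.pointBoxA`, `mulIV` (interval matrix × interval vector, `mem_mulIV`), `subIVD` (`V ⊖ x`, `mem_subIVD`);
* `CertTables.coreTP … x Hu` + `coreTP_spec` — `Σ_{n≤p} taylorJet Qb (vecF (vre x)) n i k · uⁿ ∈ coreTP[idx i k]` for `u ∈ Hu`;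
* `CertTables.inStepS`, `inStepM … H2 h JU ωinvB` + `inStepM_spec` (polynomial ± remainder scale, every `ζ` of the hull box, every
  `u ∈ [0,h]`) and `inStepM_kernel`: every real kernel `A` within `JU·ω⁻¹·u^(pV+1)` of the variational Taylor polynomial at SOME
  `ζ` of the hull (the shape of `InStepKer`, window form) lies entrywise in `inStepM` — i.e. `KerMem A (kerLo inStepM) (kerHi inStepM)`;
* `CertTables.inStepY … TP J h Min Hl x` + `inStepY_spec` — (R6) in coordinates: `tp_c + r_c + Σ_{c'} a c c' (y_{c'} − x_{c'}) ∈ inStepY[c]`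
  for `tp ∈ TP`, `|r_c| ≤ J_c·u^(p+1)`, `a ∈ Min`, `y ∈ Hl`; the read-out boxes `ylo/yhi` are its ends (so (R6) holds by construction).
(R10) is then the interval product `[inStepM]·(Vc ⊕ B·[Z])` on the composer's side (`…IntervalDMatrix` `mulII`/`mulDI`).

HONEST FRAMING: kernel bookkeeping for the MODEL certificate №23954 (rung TL-M3); nothing here is a statement about the
Navier–Stokes equations.
-/

-- the sub-problem namespace repeats the summit name by design (D-0017)
set_option linter.dupNamespace false

namespace Summit.NavierStokesRegularity.NavierStokesRegularity.Theorems.TaylorModelCert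

open scoped BigOperators
open Set
open Literature.Analysis.FluidPDE.TaoCascade Literature.Analysis.FluidPDE.TaoCascade.TaylorChain
open Summit.NavierStokesRegularity.NavierStokesRegularity.Theorems.TaylorModelReadout (qB taylorJet taylorJet_zero varJet)
open Summit.NavierStokesRegularity.NavierStokesRegularity.Theorems.TaylorModelV (basisSt)

namespace IntervalD

/-- The POINT box of a dyadic vector: `[x_c, x_c]` per coordinate. [folklore] -/
def pointBoxA (n : ℕ) (x : Array Dyad) : Array IntervalD := Array.ofFn fun c : Fin n => ofDyad (dget x c)

/-- [folklore] -/
theorem size_pointBoxA (n : ℕ) (x : Array Dyad) : (pointBoxA n x).size = n := by simp only [pointBoxA, Array.size_ofFn]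

/-- [folklore] -/
theorem mem_pointBoxA {n : ℕ} (x : Array Dyad) {c : ℕ} (hc : c < n) : mem (dget x c).toReal (aget (pointBoxA n x) c) := by
  unfold pointBoxA; rw [aget_ofFn _ hc]; exact mem_ofDyad _

/-- Rounded INTERVAL MATRIX × INTERVAL VECTOR product (rows `r < n`, columns `c < n`). [folklore] -/
def mulIV (n prec : ℕ) (M : Array (Array IntervalD)) (V : Array IntervalD) : Array IntervalD :=
  Array.ofFn fun r : Fin n => rangeSumR prec (fun c => mulR prec (imget M r c) (aget V c)) n

/-- Soundness of `mulIV`: `Σ_{c<n} a r c · v c ∈ (mulIV M V)[r]` for `a ∈ M`, `v ∈ V`. [folklore] -/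
theorem mem_mulIV {n : ℕ} (prec : ℕ) {M : Array (Array IntervalD)} {V : Array IntervalD} {a : ℕ → ℕ → ℝ} {v : ℕ → ℝ}
    (ha : MemMat n a M) (hv : MemVec n v V) {r : ℕ} (hr : r < n) :
    mem (∑ c ∈ Finset.range n, a r c * v c) (aget (mulIV n prec M V) r) := by
  unfold mulIV; rw [aget_ofFn _ hr]
  exact mem_rangeSumR prec n fun c hc => mem_mulR prec (ha r hr c hc) (hv c hc)

/-- The box `V ⊖ x` (interval vector minus a dyadic point vector, rounded outward). [folklore] -/
def subIVD (n prec : ℕ) (V : Array IntervalD) (x : Array Dyad) : Array IntervalD :=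
  Array.ofFn fun c : Fin n => subR prec (aget V c) (ofDyad (dget x c))

/-- Soundness of `subIVD`. [folklore] -/
theorem mem_subIVD {n : ℕ} (prec : ℕ) {V : Array IntervalD} (x : Array Dyad) {v : ℕ → ℝ} (hv : MemVec n v V) {c : ℕ} (hc : c < n) :
    mem (v c - (dget x c).toReal) (aget (subIVD n prec V x) c) := by
  unfold subIVD; rw [aget_ofFn _ hc]
  exact mem_subR prec (hv c hc) (mem_ofDyad _)

end IntervalD

namespace CertTables

section Defs

variable {K : Type} [Field K]

/-- **Centre Taylor polynomial over a `u`-box**: Horner at `Hu` of the order-`p` interval jets of the point box of `x`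
(`Hu = [h,h]`: the step end; `Hu = [0,h]`: the whole sub-step). [folklore] -/
def coreTP (T : CertTables K) (coefB : Fin 4 → Fin 4 → Fin 4 → ℕ → ℤ → IntervalD) (mt : Array (List (ℕ × ℕ × ℕ))) (prec p : ℕ)
    (x : Array Dyad) (Hu : IntervalD) : Array IntervalD :=
  IntervalD.polyLevelsA T.n prec (IntervalD.jetLevelsA T.n (T.qBboxMA coefB prec mt) prec (IntervalD.pointBoxA T.n x) p) p Hu

/-- In-step remainder scales `S_r ∋ JU_r · u^(pV+1)` for every `u ∈ [0,h]`. [folklore] -/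
def inStepS (T : CertTables K) (prec pV : ℕ) (JU : Array Dyad) (h : Dyad) : Array IntervalD :=
  Array.ofFn fun c : Fin T.n => IntervalD.mulR prec (IntervalD.ofDyad (dget JU c)) (IntervalD.powR prec ⟨Dyad.ofInt 0, h⟩ (pV + 1))

/-- **In-step kernel enclosure** of a sub-step over `u ∈ [0,h]`: the (M) matrix `stepMatrixMF` over the hull box `H2` at the
`u`-box `[0,h]`, with the in-step remainder scales. [folklore] -/
def inStepM (T : CertTables K) (coefB : Fin 4 → Fin 4 → Fin 4 → ℕ → ℤ → IntervalD) (prec pV : ℕ) (H2 : Array IntervalD) (h : Dyad)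
    (JU : Array Dyad) (ωinvB : Array IntervalD) : Array (Array IntervalD) :=
  T.stepMatrixMF coefB prec H2 pV ⟨Dyad.ofInt 0, h⟩ (T.inStepS prec pV JU h) ωinvB

/-- **In-step state box (R6)**: `TP[c] ⊕ ±(J_c·[0,h]^(p+1))↑ ⊕ ([Min]·(Hl ⊖ x))[c]` per coordinate. [folklore] -/
def inStepY (T : CertTables K) (prec p : ℕ) (TP : Array IntervalD) (J : Array Dyad) (h : Dyad) (Min : Array (Array IntervalD))
    (Hl : Array IntervalD) (x : Array Dyad) : Array IntervalD :=
  let hp1 := IntervalD.powR prec ⟨Dyad.ofInt 0, h⟩ (p + 1)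
  let MV := IntervalD.mulIV T.n prec Min (IntervalD.subIVD T.n prec Hl x)
  Array.ofFn fun c : Fin T.n =>
    IntervalD.addR prec
      (IntervalD.addR prec (IntervalD.aget TP c) (IntervalD.symBox (IntervalD.mulR prec (IntervalD.ofDyad (dget J c)) hp1).hi))
      (IntervalD.aget MV c)

end Defs

section Sound

variable {K : Type} [Field K] {φ : K →+* ℝ} (T : CertTables K) {coefB : Fin 4 → Fin 4 → Fin 4 → ℕ → ℤ → IntervalD}

/-- **`coreTP` encloses the centre Taylor polynomial** at every `u ∈ Hu`: for every window `(i,k)`,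
`Σ_{n≤p} taylorJet d.Qb (T.vecF (vre x)) n i k · uⁿ ∈ (coreTP …)[idx i k]`. [folklore] -/
theorem coreTP_spec (hco : T.CoefOK φ) (hcB : CoefBoxOK φ T coefB) {mt : Array (List (ℕ × ℕ × ℕ))} (hmt : mt = T.monosTable coefB)
    (prec p : ℕ) (x : Array Dyad) {Hu : IntervalD} {u : ℝ} (hu : IntervalD.mem u Hu) (i : Fin 4) {k : ℤ} (hk1 : -T.Kb ≤ k) (hk2 : k ≤ T.Ka) :
    IntervalD.mem (∑ n ∈ Finset.range (p + 1), taylorJet (T.toCertData φ).Qb (T.vecF (vre x)) n i k * u ^ n)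
      (IntervalD.aget (T.coreTP coefB mt prec p x Hu) (T.idx i k)) := by
  have hk : -T.Kb ≤ k ∧ k ≤ T.Ka := ⟨hk1, hk2⟩
  have hc : T.idx i k < T.n := T.idx_lt_n i hk
  have hQBA : IntervalD.IsFieldEnclosureA T.wv (qBf (T.toCertData φ)) T.n (T.qBboxMA coefB prec mt) := by
    rw [hmt]; exact T.isFieldEnclosureA_qBboxMA hco hcB prec
  have hx : ∀ c < T.n, IntervalD.mem (T.wv (T.vecF (vre x)) c) (IntervalD.aget (IntervalD.pointBoxA T.n x) c) := fun c hc' => by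
    rw [T.wv_vecF _ hc']; exact IntervalD.mem_pointBoxA x hc'
  have hpoly := IntervalD.mem_taylorPoly_of_jetLevelsA (rd := T.wv) (Q := qBf (T.toCertData φ)) (T := taylorJet (qBf (T.toCertData φ)))
    (fun y c _ => by rw [taylorJet_zero]) (fun y k c _ => T.wv_taylorJet_qBf_succ y k c) hQBA prec p (IntervalD.size_pointBoxA T.n x) hx
    hu (T.idx i k) hc
  simp only [taylorJet_qBf, T.wv_idx _ i hk] at hpoly
  exact hpoly

/-- **`inStepM` encloses polynomial ± remainder scale** for every `ζ` of the hull box and every `u ∈ [0,h]`: for all windows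
`(i,k)`, `(i',k')`: `lo ≤ Σ_{n≤pV} varJet Qb ζ (basisSt i k) n i' k' uⁿ − JU_{i'k'}·ω_k⁻¹·u^(pV+1)` and `… + … ≤ hi` at entry
`(idx i' k', idx i k)`. [folklore] -/
theorem inStepM_spec (hco : T.CoefOK φ) (hcB : CoefBoxOK φ T coefB) (prec pV : ℕ) {H2 : Array IntervalD} (hH2 : H2.size = T.n)
    {ζ : Fin 4 → ℤ → ℝ} (hζ : MemVec T.n (T.wv ζ) H2) {h : Dyad} {u : ℝ} (hu0 : 0 ≤ u) (huh : u ≤ h.toReal) (JU : Array Dyad)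
    {ω : ℤ → ℝ} {ωinvB : Array IntervalD} (hω : ∀ i k, -T.Kb ≤ k → k ≤ T.Ka → IntervalD.mem ((ω k)⁻¹) (IntervalD.aget ωinvB (T.idx i k)))
    (i : Fin 4) {k : ℤ} (hk1 : -T.Kb ≤ k) (hk2 : k ≤ T.Ka) (i' : Fin 4) {k' : ℤ} (hk1' : -T.Kb ≤ k') (hk2' : k' ≤ T.Ka) :
    (imget (T.inStepM coefB prec pV H2 h JU ωinvB) (T.idx i' k') (T.idx i k)).lo.toReal ≤
        (∑ n ∈ Finset.range (pV + 1), varJet (T.toCertData φ).Qb ζ (basisSt i k) n i' k' * u ^ n) -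
          vre JU (T.idx i' k') * (ω k)⁻¹ * u ^ (pV + 1) ∧
      (∑ n ∈ Finset.range (pV + 1), varJet (T.toCertData φ).Qb ζ (basisSt i k) n i' k' * u ^ n) +
          vre JU (T.idx i' k') * (ω k)⁻¹ * u ^ (pV + 1) ≤
        (imget (T.inStepM coefB prec pV H2 h JU ωinvB) (T.idx i' k') (T.idx i k)).hi.toReal := by
  have hU : IntervalD.mem u ⟨Dyad.ofInt 0, h⟩ := IntervalD.mem_zeroTo hu0 huh
  have hS : ∀ i' k', -T.Kb ≤ k' → k' ≤ T.Ka →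
      IntervalD.mem ((fun i' k' => vre JU (T.idx i' k')) i' k' * u ^ (pV + 1)) (IntervalD.aget (T.inStepS prec pV JU h) (T.idx i' k')) := by
    intro i' k' h1 h2
    have hc : T.idx i' k' < T.n := T.idx_lt_n i' ⟨h1, h2⟩
    unfold inStepS; rw [IntervalD.aget_ofFn _ hc]
    exact IntervalD.mem_mulR prec (IntervalD.mem_ofDyad _) (IntervalD.mem_powR prec hU _)
  exact T.stepMatrixMF_spec hco hcB prec pV hH2 hζ hU hS hω i hk1 hk2 i' hk1' hk2'

/-- **Every in-step kernel lies in `inStepM`** (window form of `InStepKer`): if each window entry of the real kernel `A` is within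
`vecF (vre JU) i' k' · ω_k⁻¹ · u^(pV+1)` of the variational Taylor polynomial at SOME state of the hull box `[loR H2, hiR H2]`, and
`u ∈ [0,h]`, then `A` lies entrywise in `inStepM` (`= KerMem A (kerLo ·) (kerHi ·)` on the composer's side). [folklore] -/
theorem inStepM_kernel (hco : T.CoefOK φ) (hcB : CoefBoxOK φ T coefB) (prec pV : ℕ) {H2 : Array IntervalD} (hH2 : H2.size = T.n)
    {h : Dyad} {u : ℝ} (hu0 : 0 ≤ u) (huh : u ≤ h.toReal) (JU : Array Dyad)
    {ω : ℤ → ℝ} {ωinvB : Array IntervalD} (hω : ∀ i k, -T.Kb ≤ k → k ≤ T.Ka → IntervalD.mem ((ω k)⁻¹) (IntervalD.aget ωinvB (T.idx i k)))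
    {A : Fin 4 → ℤ → Fin 4 → ℤ → ℝ}
    (hA : ∀ i' k', -T.Kb ≤ k' → k' ≤ T.Ka → ∀ i k, -T.Kb ≤ k → k ≤ T.Ka →
      ∃ ζ : Fin 4 → ℤ → ℝ, T.InBoxW (T.vecF (IntervalD.loR H2)) (T.vecF (IntervalD.hiR H2)) ζ ∧
        |A i' k' i k - ∑ n ∈ Finset.range (pV + 1), varJet (T.toCertData φ).Qb ζ (basisSt i k) n i' k' * u ^ n|
          ≤ T.vecF (vre JU) i' k' * (ω k)⁻¹ * u ^ (pV + 1))
    (i' : Fin 4) {k' : ℤ} (hk1' : -T.Kb ≤ k') (hk2' : k' ≤ T.Ka) (i : Fin 4) {k : ℤ} (hk1 : -T.Kb ≤ k) (hk2 : k ≤ T.Ka) :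
    (imget (T.inStepM coefB prec pV H2 h JU ωinvB) (T.idx i' k') (T.idx i k)).lo.toReal ≤ A i' k' i k ∧
      A i' k' i k ≤ (imget (T.inStepM coefB prec pV H2 h JU ωinvB) (T.idx i' k') (T.idx i k)).hi.toReal := by
  obtain ⟨ζ, hζB, hAζ⟩ := hA i' k' hk1' hk2' i k hk1 hk2
  have hζ : MemVec T.n (T.wv ζ) H2 := T.mem_of_inBoxW_loR hζB
  have hM := T.inStepM_spec hco hcB prec pV hH2 hζ hu0 huh JU hω i hk1 hk2 i' hk1' hk2'
  rw [T.vecF_apply, if_pos ⟨hk1', hk2'⟩] at hAζ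
  have h1 := (abs_le.1 hAζ).1
  have h2 := (abs_le.1 hAζ).2
  constructor <;> linarith [hM.1, hM.2]

omit [Field K] in
/-- **Soundness of the in-step state box (R6), in coordinates**: for `u ∈ [0,h]`, `tp ∈ TP`, `|r_c| ≤ J_c·u^(p+1)`, a real matrix
`a ∈ Min` and a state `y ∈ Hl` (coordinate values `yv`), `tp_c + r_c + Σ_{c'} a c c'·(yv c' − x_{c'}) ∈ inStepY[c]`. [folklore] -/
theorem inStepY_spec (prec p : ℕ) {TP : Array IntervalD} {tp : ℕ → ℝ} (htp : ∀ c < T.n, IntervalD.mem (tp c) (IntervalD.aget TP c))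
    {J : Array Dyad} {h : Dyad} {u : ℝ} (hu0 : 0 ≤ u) (huh : u ≤ h.toReal) {rr : ℕ → ℝ}
    (hr : ∀ c < T.n, |rr c| ≤ (dget J c).toReal * u ^ (p + 1))
    {Min : Array (Array IntervalD)} {a : ℕ → ℕ → ℝ} (ha : MemMat T.n a Min)
    {Hl : Array IntervalD} {yv : ℕ → ℝ} (hy : MemVec T.n yv Hl) (x : Array Dyad) {c : ℕ} (hc : c < T.n) :
    IntervalD.mem (tp c + rr c + ∑ c' ∈ Finset.range T.n, a c c' * (yv c' - (dget x c').toReal))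
      (IntervalD.aget (T.inStepY prec p TP J h Min Hl x) c) := by
  have hU : IntervalD.mem u ⟨Dyad.ofInt 0, h⟩ := IntervalD.mem_zeroTo hu0 huh
  have hJ : IntervalD.mem ((dget J c).toReal * u ^ (p + 1))
      (IntervalD.mulR prec (IntervalD.ofDyad (dget J c)) (IntervalD.powR prec ⟨Dyad.ofInt 0, h⟩ (p + 1))) :=
    IntervalD.mem_mulR prec (IntervalD.mem_ofDyad _) (IntervalD.mem_powR prec hU _)
  have hrr : IntervalD.mem (rr c)
      (IntervalD.symBox (IntervalD.mulR prec (IntervalD.ofDyad (dget J c)) (IntervalD.powR prec ⟨Dyad.ofInt 0, h⟩ (p + 1))).hi) :=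
    IntervalD.mem_symBox (le_trans (hr c hc) hJ.2)
  have hMV := IntervalD.mem_mulIV prec ha (fun c' hc' => IntervalD.mem_subIVD prec x hy hc') hc
  unfold inStepY
  rw [IntervalD.aget_ofFn _ hc]
  exact IntervalD.mem_addR prec (IntervalD.mem_addR prec (htp c hc) hrr) hMV

end Sound

end CertTables

end Summit.NavierStokesRegularity.NavierStokesRegularity.Theorems.TaylorModelCert
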